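import Mathlib.Analysis.SpecialFunctions.ImproperIntegrals
import Mathlib.Analysis.SpecialFunctions.Integrals.Basic
import Mathlib.Analysis.SpecialFunctions.Integrability.Basic
import Mathlib.MeasureTheory.Integral.Prod
import Mathlib.MeasureTheory.Measure.Haar.NormedSpace
import HarnessLib

/-!
# Volkov 2020 (NPB 961, 115232) §1, the «mixed form» toy `∫∫ dxdy/(x⁴y²+1)`: the footnote's two closed forms — over `{x ≥ λ; y > 0}` the integral is `C/λ` with `C = ∫₀^∞ dt/(t²+1)` (`= π/2`), over `{x > 0; y ≤ Λ}` it is `2C√Λ` with `C = ∫₀^∞ dt/(t⁴+1)` — and the three printed limit statements (each single limit of `f(λ,Λ)` finite, the simultaneous limit infinite), PROVED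

independent recomputation; certified where stated, statistical where stated; no new-physics claim.

CITATION HEADER (venture `QEDPrecision`, cell `pub-qed`, track TROPICAL seat V3b = `pub-qed-trop-v3-lit-2` gen 10; VALUE-FREE: a two-variable
calculus toy printed by the source; nothing per graph or per word). Companion of `Volkov2020.MixedDivergenceToy` (gen 6: the integrand's
two-sided monomial bound and the DERIVED ray exponent `toyE`; its docstring lists as NOT claimed "the values of the integrals (the footnote's
C/λ and 2C√Λ), any measure-theoretic statement") — this file supplies exactly those: the measure-theoretic reading of the printed passage.
Serves `tropical/view/V3-VOLKOV-DEGREES.md` §B.23 / §B.33 (last row: "✗ the footnote's closed-form integrals" becomes ✓).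

Source. [Volkov2020] S. Volkov, "Infrared and ultraviolet power counting on the mass shell in quantum electrodynamics", Nucl. Phys. B 961
(2020) 115232 = arXiv:1912.04885v4, §1 (journal p.4; e-print tex l.105–107 of `iclos_arxiv.tex` held under
`pub-qed-trop-v3-lit-2/sources/arxiv-1912.04885/`), VERBATIM: "Also, IR and UV divergences can occur in a mixed form. This can be illustrated
by the simple integral f(λ,Λ) = ∫_λ^Λ dxdy/(x⁴y²+1), 0 < λ < Λ. It is easy to see that lim_{λ→0} f(λ,Λ) is finite for any fixed Λ as well as
lim_{Λ→+∞} f(λ,Λ) is finite for any fixed λ > 0. However, the simultaneous limit lim_{λ→0,Λ→+∞} f(λ,Λ) is infinite [footnote: The integral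
over the domain {x ≥ λ; y > 0} equals C∫_λ^{+∞} dx/x² = C/λ, where C = ∫₀^{+∞} dt/(t²+1), but over {x > 0; y ≤ Λ} it equals C∫₀^Λ dx/√x
= 2C√Λ, where C = ∫₀^{+∞} dt/(t⁴+1).]"

READING. `f(λ,Λ)` is the Lebesgue (Bochner) integral of `1/(x⁴y²+1)` over the open square `(λ,Λ)²` (boundaries are null); the footnote's
domains are `Ioi λ ×ˢ Ioi 0` and `Ioi 0 ×ˢ Ioc 0 Λ` (the variables of the toy are positive); "C∫_λ^∞ dx/x²" and "C∫₀^Λ dx/√x" are the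
iterated integrals after the inner substitution `t = x²y`, resp. `t = √y·x`; "the simultaneous limit is infinite" is typed as (a) an explicit
lower bound `1/(16 s) ≤ f(λ,Λ)` once `λ ≤ min(s, 1/(8s²))` and `Λ ≥ max(2s, 1/(4s²))`, hence `f` exceeds every `T` for all small `λ` and large
`Λ`, and (b) non-integrability of the integrand on the open quadrant.

WHAT THE KERNEL CERTIFIES (all PROVED, Mathlib only; no definition, no named fact, D-0026):
* §1 `integral_Ioi_inv_sq_add_one` (`∫₀^∞ dt/(t²+1) = π/2`, Mathlib's arctan evaluation), `integrable_inv_pow_four_add_one` (`1/(t⁴+1)` is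
  integrable on ℝ: dominated by `2/(1+t²)`).
* §2 the inner substitutions: `integral_Ioi_toy_dy` (`∫₀^∞ dy/(x⁴y²+1) = (π/2)/x²`, `t = x²y`), `integral_Ioi_toy_dx`
  (`∫₀^∞ dx/(x⁴y²+1) = C′/√y`, `C′ = ∫₀^∞ dt/(t⁴+1)`, `t = √y·x`).
* §3 THE FOOTNOTE: `integral_toy_strip_x` (`∫_{x>λ} ∫_{y>0} = (π/2)/λ` — "C∫_λ^∞ dx/x² = C/λ"), `integral_toy_strip_y`
  (`∫_{0<y≤Λ} ∫_{x>0} = 2C′√Λ` — "C∫₀^Λ dx/√x = 2C√Λ"); and as genuine two-dimensional integrals `integrableOn_toy_strip_x` /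
  `setIntegral_toy_strip_x` (`∫_{Ioi λ ×ˢ Ioi 0} = (π/2)/λ`) and `integrableOn_toy_strip_y` / `setIntegral_toy_strip_y`
  (`∫_{Ioi 0 ×ˢ Ioc 0 Λ} = 2C′√Λ`), by Fubini with the integrability obtained from the computed inner integrals.
* §4 THE THREE LIMIT STATEMENTS for `f(λ,Λ) = ∫_{(λ,Λ)²}`: `toySquare_le_strip_x` (`f(λ,Λ) ≤ (π/2)/λ` — bounded as Λ → ∞ for fixed λ),
  `toySquare_le_strip_y` (`f(λ,Λ) ≤ 2C′√Λ` — bounded as λ → 0 for fixed Λ), `toySquare_ge` / **`toySquare_unbounded`** (for every `T`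
  there are `λ₀ > 0`, `Λ₀` with `T ≤ f(λ,Λ)` whenever `0 < λ ≤ λ₀`, `Λ₀ ≤ Λ` — "the simultaneous limit … is infinite"), and
  **`not_integrableOn_toy_quadrant`** (`1/(x⁴y²+1)` is not integrable on `{x > 0, y > 0}`: the strips `{x > λ}` alone carry `(π/2)/λ`).
NOT claimed: a closed form for `C′ = ∫₀^∞ dt/(t⁴+1)` (the source leaves it as a constant; it is `π/(2√2)`), anything about Feynman integrands.
-/

namespace Literature.MathematicalPhysics.QuantumFieldTheory.Volkov2020

open MeasureTheory Set Real

noncomputable section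

/-! ## §1 The two one-dimensional constants of the footnote -/

/-- `C = ∫₀^{+∞} dt/(t²+1) = π/2` (the footnote's first constant, evaluated).
[cite: Volkov2020, §1 footnote to "the simultaneous limit … is infinite" (journal p.4; arXiv:1912.04885v4 tex l.107)] -/
theorem integral_Ioi_inv_sq_add_one : ∫ t in Ioi (0:ℝ), 1 / (t ^ 2 + 1) = π / 2 := by
  have h : ∫ t in Ioi (0:ℝ), (1 + t ^ 2)⁻¹ = π / 2 - arctan 0 := integral_Ioi_inv_one_add_sq
  rw [arctan_zero, sub_zero] at h
  rw [← h]
  refine setIntegral_congr_fun measurableSet_Ioi fun t _ => ?_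
  rw [one_div, add_comm]

/-- `0 ≤ 2t⁴ − t² + 1`, i.e. `1/(t⁴+1) ≤ 2/(1+t²)`: the domination used for the second constant. [cite: Volkov2020, §1 footnote (tex l.107)] -/
theorem inv_pow_four_add_one_le (t : ℝ) : 1 / (t ^ 4 + 1) ≤ 2 * (1 + t ^ 2)⁻¹ := by
  rw [← one_div, mul_one_div, div_le_div_iff₀ (by positivity) (by positivity)]
  nlinarith [sq_nonneg (t ^ 2 - 1 / 4), sq_nonneg t]

/-- `C′ = ∫₀^{+∞} dt/(t⁴+1)` is a genuine (finite) constant: `1/(t⁴+1)` is integrable on ℝ.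
[cite: Volkov2020, §1 footnote (journal p.4; tex l.107)] -/
theorem integrable_inv_pow_four_add_one : Integrable fun t : ℝ => 1 / (t ^ 4 + 1) := by
  refine Integrable.mono' (integrable_inv_one_add_sq.const_mul 2) ?_ (Filter.Eventually.of_forall fun t => ?_)
  · exact (Measurable.aestronglyMeasurable (by fun_prop))
  · rw [Real.norm_eq_abs, abs_of_pos (by positivity)]
    exact inv_pow_four_add_one_le t

/-- `C′ > 0`. [cite: Volkov2020, §1 footnote (tex l.107)] -/
theorem integral_Ioi_inv_pow_four_add_one_pos : 0 < ∫ t in Ioi (0:ℝ), 1 / (t ^ 4 + 1) := by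
  have hint : IntegrableOn (fun t : ℝ => 1 / (t ^ 4 + 1)) (Ioi 0) := integrable_inv_pow_four_add_one.integrableOn
  rw [setIntegral_pos_iff_support_of_nonneg_ae (Filter.Eventually.of_forall fun t => by positivity) hint]
  have hsupp : Function.support (fun t : ℝ => 1 / (t ^ 4 + 1)) = univ := by
    refine eq_univ_of_forall fun t => ?_
    rw [Function.mem_support]
    positivity
  rw [hsupp, univ_inter, Real.volume_Ioi]
  exact ENNReal.zero_lt_top

/-! ## §2 The inner integrals: the substitutions `t = x²y` and `t = √y·x` -/

/-- For `x > 0`: `∫₀^∞ dy/(x⁴y²+1) = (π/2)/x²` (substitute `t = x²·y`). [cite: Volkov2020, §1 footnote ("C∫_λ^{+∞} dx/x²") (tex l.107)] -/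
theorem integral_Ioi_toy_dy {x : ℝ} (hx : 0 < x) :
    ∫ y in Ioi (0:ℝ), 1 / (x ^ 4 * y ^ 2 + 1) = (π / 2) / x ^ 2 := by
  have hx2 : 0 < x ^ 2 := by positivity
  have h := integral_comp_mul_left_Ioi (fun t : ℝ => 1 / (t ^ 2 + 1)) 0 hx2
  simp only [mul_zero, smul_eq_mul] at h
  rw [integral_Ioi_inv_sq_add_one] at h
  have hfun : ∀ y ∈ Ioi (0:ℝ), 1 / (x ^ 4 * y ^ 2 + 1) = (fun t : ℝ => 1 / (t ^ 2 + 1)) (x ^ 2 * y) := by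
    intro y _
    simp only
    ring
  rw [setIntegral_congr_fun measurableSet_Ioi hfun, h]
  field_simp

/-- For `y > 0`: `∫₀^∞ dx/(x⁴y²+1) = C′/√y`, `C′ = ∫₀^∞ dt/(t⁴+1)` (substitute `t = √y·x`).
[cite: Volkov2020, §1 footnote ("C∫₀^Λ dx/√x") (tex l.107)] -/
theorem integral_Ioi_toy_dx {y : ℝ} (hy : 0 < y) :
    ∫ x in Ioi (0:ℝ), 1 / (x ^ 4 * y ^ 2 + 1) = (∫ t in Ioi (0:ℝ), 1 / (t ^ 4 + 1)) / √y := by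
  have hs : 0 < √y := Real.sqrt_pos.2 hy
  have h := integral_comp_mul_left_Ioi (fun t : ℝ => 1 / (t ^ 4 + 1)) 0 hs
  simp only [mul_zero, smul_eq_mul] at h
  have h4 : (√y) ^ 4 = y ^ 2 := by
    rw [show (4:ℕ) = 2 * 2 from rfl, pow_mul, Real.sq_sqrt hy.le]
  have hfun : ∀ x ∈ Ioi (0:ℝ), 1 / (x ^ 4 * y ^ 2 + 1) = (fun t : ℝ => 1 / (t ^ 4 + 1)) (√y * x) := by
    intro x _
    simp only
    rw [mul_pow, h4]
    ring
  rw [setIntegral_congr_fun measurableSet_Ioi hfun, h, div_eq_inv_mul]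

/-! ## §3 The footnote: the two strips -/

/-- **"The integral over the domain {x ≥ λ; y > 0} equals C∫_λ^{+∞} dx/x² = C/λ, where C = ∫₀^{+∞} dt/(t²+1)"** — as the iterated
integral, with `C = π/2`. [cite: Volkov2020, §1 footnote (journal p.4; arXiv:1912.04885v4 tex l.107)] -/
theorem integral_toy_strip_x {l : ℝ} (hl : 0 < l) :
    ∫ x in Ioi l, ∫ y in Ioi (0:ℝ), 1 / (x ^ 4 * y ^ 2 + 1) = (π / 2) / l := by
  have h1 : ∀ x ∈ Ioi l, ∫ y in Ioi (0:ℝ), 1 / (x ^ 4 * y ^ 2 + 1) = (π / 2) * x ^ (-2:ℝ) := by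
    intro x hx
    have hx : 0 < x := hl.trans hx
    rw [integral_Ioi_toy_dy hx, Real.rpow_neg hx.le, Real.rpow_two]
    ring
  rw [setIntegral_congr_fun measurableSet_Ioi h1, integral_const_mul,
    integral_Ioi_rpow_of_lt (by norm_num : (-2:ℝ) < -1) hl]
  have e : (-2:ℝ) + 1 = -1 := by norm_num
  rw [e, Real.rpow_neg_one]
  field_simp

/-- **"… but over {x > 0; y ≤ Λ} it equals C∫₀^Λ dx/√x = 2C√Λ, where C = ∫₀^{+∞} dt/(t⁴+1)"** — as the iterated integral (outer
variable `y ∈ (0, Λ]`, inner `x > 0`). [cite: Volkov2020, §1 footnote (journal p.4; arXiv:1912.04885v4 tex l.107)] -/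
theorem integral_toy_strip_y {L : ℝ} (hL : 0 < L) :
    ∫ y in Ioc 0 L, ∫ x in Ioi (0:ℝ), 1 / (x ^ 4 * y ^ 2 + 1) =
      2 * (∫ t in Ioi (0:ℝ), 1 / (t ^ 4 + 1)) * √L := by
  set C' := ∫ t in Ioi (0:ℝ), 1 / (t ^ 4 + 1) with hC'
  have h1 : ∀ y ∈ Ioc 0 L, ∫ x in Ioi (0:ℝ), 1 / (x ^ 4 * y ^ 2 + 1) = C' * y ^ (-(1 / 2):ℝ) := by
    intro y hy
    rw [integral_Ioi_toy_dx hy.1, Real.rpow_neg hy.1.le, ← Real.sqrt_eq_rpow y]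
    ring
  rw [setIntegral_congr_fun measurableSet_Ioc h1, integral_const_mul, ← intervalIntegral.integral_of_le hL.le,
    integral_rpow (Or.inl (by norm_num : (-1:ℝ) < -(1 / 2)))]
  have e : (-(1 / 2):ℝ) + 1 = 1 / 2 := by norm_num
  rw [e, Real.zero_rpow (by norm_num), sub_zero, ← Real.sqrt_eq_rpow L]
  ring

/-! ### The same two strips as genuine two-dimensional (Lebesgue) integrals -/

/-- The toy integrand on `ℝ²` is measurable. [cite: Volkov2020, §1 (tex l.107)] -/
theorem measurable_toy : Measurable fun p : ℝ × ℝ => 1 / (p.1 ^ 4 * p.2 ^ 2 + 1) := by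
  fun_prop

/-- The toy integrand is non-negative. [cite: Volkov2020, §1 (tex l.107)] -/
theorem toy_nonneg (p : ℝ × ℝ) : 0 ≤ 1 / (p.1 ^ 4 * p.2 ^ 2 + 1) := by positivity

/-- The toy integrand is at most `1`. [cite: Volkov2020, §1 (tex l.107)] -/
theorem toy_le_one (p : ℝ × ℝ) : 1 / (p.1 ^ 4 * p.2 ^ 2 + 1) ≤ 1 := by
  rw [div_le_one (by positivity)]
  nlinarith [sq_nonneg (p.1 ^ 2 * p.2)]

/-- `1/(x⁴y²+1)` is integrable on the strip `{x > λ} × {y > 0}` (`λ > 0`): Fubini–Tonelli with the inner integral `(π/2)/x²`.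
[cite: Volkov2020, §1 footnote ("The integral over the domain {x ≥ λ; y > 0} equals … C/λ") (tex l.107)] -/
theorem integrableOn_toy_strip_x {l : ℝ} (hl : 0 < l) :
    IntegrableOn (fun p : ℝ × ℝ => 1 / (p.1 ^ 4 * p.2 ^ 2 + 1)) (Ioi l ×ˢ Ioi 0)
      ((volume : Measure ℝ).prod volume) := by
  rw [IntegrableOn, ← Measure.prod_restrict, integrable_prod_iff measurable_toy.aestronglyMeasurable]
  refine ⟨?_, ?_⟩
  · refine ae_restrict_of_forall_mem measurableSet_Ioi fun x hx => ?_
    have hx : 0 < x := hl.trans hx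
    have hg : Integrable fun y : ℝ => (1 + (x ^ 2 * y) ^ 2)⁻¹ :=
      integrable_inv_one_add_sq.comp_mul_left' (by positivity : x ^ 2 ≠ 0)
    refine (hg.integrableOn (s := Ioi 0)).congr_fun (fun y _ => ?_) measurableSet_Ioi
    simp only [inv_eq_one_div]
    ring
  · have hI : IntegrableOn (fun x : ℝ => (π / 2) * x ^ (-2:ℝ)) (Ioi l) :=
      (integrableOn_Ioi_rpow_of_lt (by norm_num : (-2:ℝ) < -1) hl).const_mul (π / 2)
    refine hI.congr_fun (fun x hx => ?_) measurableSet_Ioi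
    have hx : 0 < x := hl.trans hx
    have hnorm : ∀ y ∈ Ioi (0:ℝ), ‖1 / ((x, y).1 ^ 4 * (x, y).2 ^ 2 + 1)‖ = 1 / (x ^ 4 * y ^ 2 + 1) := by
      intro y _
      rw [Real.norm_of_nonneg (toy_nonneg (x, y))]
    beta_reduce
    rw [setIntegral_congr_fun measurableSet_Ioi hnorm, integral_Ioi_toy_dy hx, Real.rpow_neg hx.le, Real.rpow_two]
    ring

/-- **"The integral over the domain {x ≥ λ; y > 0} equals … C/λ"** as a two-dimensional Lebesgue integral: `∫_{(λ,∞)×(0,∞)} dxdy/(x⁴y²+1)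
= (π/2)/λ`. [cite: Volkov2020, §1 footnote (journal p.4; arXiv:1912.04885v4 tex l.107)] -/
theorem setIntegral_toy_strip_x {l : ℝ} (hl : 0 < l) :
    ∫ p in Ioi l ×ˢ Ioi (0:ℝ), 1 / (p.1 ^ 4 * p.2 ^ 2 + 1) = (π / 2) / l := by
  rw [Measure.volume_eq_prod, setIntegral_prod _ (integrableOn_toy_strip_x hl)]
  exact integral_toy_strip_x hl

/-- `1/(x⁴y²+1)` is integrable on the strip `{x > 0} × {0 < y ≤ Λ}`: Fubini–Tonelli with the inner integral `C′/√y`.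
[cite: Volkov2020, §1 footnote ("over {x > 0; y ≤ Λ} it equals … 2C√Λ") (tex l.107)] -/
theorem integrableOn_toy_strip_y {L : ℝ} (hL : 0 < L) :
    IntegrableOn (fun p : ℝ × ℝ => 1 / (p.1 ^ 4 * p.2 ^ 2 + 1)) (Ioi 0 ×ˢ Ioc 0 L)
      ((volume : Measure ℝ).prod volume) := by
  rw [IntegrableOn, ← Measure.prod_restrict, integrable_prod_iff' measurable_toy.aestronglyMeasurable]
  refine ⟨?_, ?_⟩
  · refine ae_restrict_of_forall_mem measurableSet_Ioc fun y hy => ?_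
    have hs : 0 < √y := Real.sqrt_pos.2 hy.1
    have h4 : (√y) ^ 4 = y ^ 2 := by
      rw [show (4:ℕ) = 2 * 2 from rfl, pow_mul, Real.sq_sqrt hy.1.le]
    have hg : Integrable fun x : ℝ => 1 / ((√y * x) ^ 4 + 1) :=
      integrable_inv_pow_four_add_one.comp_mul_left' hs.ne'
    refine (hg.integrableOn (s := Ioi 0)).congr_fun (fun x _ => ?_) measurableSet_Ioi
    simp only
    rw [mul_pow, h4]
    ring
  · set C' := ∫ t in Ioi (0:ℝ), 1 / (t ^ 4 + 1) with hC'
    have hI : IntegrableOn (fun y : ℝ => C' * y ^ (-(1 / 2):ℝ)) (Ioc 0 L) :=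
      ((intervalIntegrable_iff_integrableOn_Ioc_of_le hL.le).1
        (intervalIntegral.intervalIntegrable_rpow' (a := 0) (b := L) (by norm_num : (-1:ℝ) < -(1 / 2)))).const_mul C'
    refine hI.congr_fun (fun y hy => ?_) measurableSet_Ioc
    have hnorm : ∀ x ∈ Ioi (0:ℝ), ‖1 / ((x, y).1 ^ 4 * (x, y).2 ^ 2 + 1)‖ = 1 / (x ^ 4 * y ^ 2 + 1) := by
      intro x _
      rw [Real.norm_of_nonneg (toy_nonneg (x, y))]
    beta_reduce
    rw [setIntegral_congr_fun measurableSet_Ioi hnorm, integral_Ioi_toy_dx hy.1, Real.rpow_neg hy.1.le,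
      ← Real.sqrt_eq_rpow y]
    ring

/-- **"over {x > 0; y ≤ Λ} it equals … 2C√Λ, where C = ∫₀^{+∞} dt/(t⁴+1)"** as a two-dimensional Lebesgue integral:
`∫_{(0,∞)×(0,Λ]} dxdy/(x⁴y²+1) = 2C′√Λ`. [cite: Volkov2020, §1 footnote (journal p.4; arXiv:1912.04885v4 tex l.107)] -/
theorem setIntegral_toy_strip_y {L : ℝ} (hL : 0 < L) :
    ∫ p in Ioi (0:ℝ) ×ˢ Ioc 0 L, 1 / (p.1 ^ 4 * p.2 ^ 2 + 1) = 2 * (∫ t in Ioi (0:ℝ), 1 / (t ^ 4 + 1)) * √L := by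
  have hint := integrableOn_toy_strip_y hL
  rw [IntegrableOn, ← Measure.prod_restrict] at hint
  rw [Measure.volume_eq_prod, ← Measure.prod_restrict, integral_prod_symm _ hint]
  exact integral_toy_strip_y hL

/-! ## §4 `f(λ,Λ) = ∫_{(λ,Λ)²} dxdy/(x⁴y²+1)`: each single limit finite, the simultaneous limit infinite -/

/-- The square `(λ,Λ)²` lies in the strip `{x > λ} × {y > 0}` when `λ > 0`. [cite: Volkov2020, §1 (tex l.107)] -/
theorem square_subset_strip_x {l L : ℝ} (hl : 0 < l) : Ioo l L ×ˢ Ioo l L ⊆ Ioi l ×ˢ Ioi (0:ℝ) :=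
  prod_mono Ioo_subset_Ioi_self fun _ hy => hl.trans hy.1

/-- The square `(λ,Λ)²` lies in the strip `{x > 0} × {0 < y ≤ Λ}` when `λ > 0`. [cite: Volkov2020, §1 (tex l.107)] -/
theorem square_subset_strip_y {l L : ℝ} (hl : 0 < l) : Ioo l L ×ˢ Ioo l L ⊆ Ioi (0:ℝ) ×ˢ Ioc 0 L :=
  prod_mono (fun _ hx => hl.trans hx.1) fun _ hy => ⟨hl.trans hy.1, hy.2.le⟩

/-- `f(λ,Λ)` exists as a Lebesgue integral: the integrand is integrable on the square. [cite: Volkov2020, §1 (tex l.107)] -/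
theorem integrableOn_toy_square {l L : ℝ} (hl : 0 < l) :
    IntegrableOn (fun p : ℝ × ℝ => 1 / (p.1 ^ 4 * p.2 ^ 2 + 1)) (Ioo l L ×ˢ Ioo l L) := by
  rw [Measure.volume_eq_prod]
  exact (integrableOn_toy_strip_x hl).mono_set (square_subset_strip_x hl)

/-- **"lim_{Λ→+∞} f(λ,Λ) is finite for any fixed λ > 0"**: `f(λ,Λ) ≤ (π/2)/λ` for every `Λ`.
[cite: Volkov2020, §1 (journal p.4; arXiv:1912.04885v4 tex l.107)] -/
theorem toySquare_le_strip_x {l : ℝ} (hl : 0 < l) (L : ℝ) :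
    ∫ p in Ioo l L ×ˢ Ioo l L, 1 / (p.1 ^ 4 * p.2 ^ 2 + 1) ≤ (π / 2) / l := by
  rw [← setIntegral_toy_strip_x hl]
  have hint : IntegrableOn (fun p : ℝ × ℝ => 1 / (p.1 ^ 4 * p.2 ^ 2 + 1)) (Ioi l ×ˢ Ioi 0) := by
    rw [Measure.volume_eq_prod]; exact integrableOn_toy_strip_x hl
  exact setIntegral_mono_set hint (Filter.Eventually.of_forall fun p => toy_nonneg p)
    (square_subset_strip_x hl).eventuallyLE

/-- **"lim_{λ→0} f(λ,Λ) is finite for any fixed Λ"**: `f(λ,Λ) ≤ 2C′√Λ` for every `0 < λ` (`Λ > 0`).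
[cite: Volkov2020, §1 (journal p.4; arXiv:1912.04885v4 tex l.107)] -/
theorem toySquare_le_strip_y {l L : ℝ} (hl : 0 < l) (hL : 0 < L) :
    ∫ p in Ioo l L ×ˢ Ioo l L, 1 / (p.1 ^ 4 * p.2 ^ 2 + 1) ≤ 2 * (∫ t in Ioi (0:ℝ), 1 / (t ^ 4 + 1)) * √L := by
  rw [← setIntegral_toy_strip_y hL]
  have hint : IntegrableOn (fun p : ℝ × ℝ => 1 / (p.1 ^ 4 * p.2 ^ 2 + 1)) (Ioi 0 ×ˢ Ioc 0 L) := by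
    rw [Measure.volume_eq_prod]; exact integrableOn_toy_strip_y hL
  exact setIntegral_mono_set hint (Filter.Eventually.of_forall fun p => toy_nonneg p)
    (square_subset_strip_y hl).eventuallyLE

/-- An explicit lower bound along the kink `x⁴y² ≍ 1`: for `s > 0`, once `λ ≤ min(s, 1/(8s²))` and `Λ ≥ max(2s, 1/(4s²))`, the box
`(s,2s) × (λ, 1/(4s²))` lies in the square, the integrand is `≥ 1/2` on it (there `x⁴y² ≤ 1`), and its area is `≥ 1/(8s)`; hence
`f(λ,Λ) ≥ 1/(16s)`. [cite: Volkov2020, §1 "the simultaneous limit lim_{λ→0,Λ→+∞} f(λ,Λ) is infinite" (tex l.107); the box is this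
file's reading] -/
theorem toySquare_ge {s l L : ℝ} (hs : 0 < s) (hl : 0 < l) (hls : l ≤ s) (hls' : l ≤ 1 / (8 * s ^ 2))
    (hL : 2 * s ≤ L) (hL' : 1 / (4 * s ^ 2) ≤ L) :
    1 / (16 * s) ≤ ∫ p in Ioo l L ×ˢ Ioo l L, 1 / (p.1 ^ 4 * p.2 ^ 2 + 1) := by
  set B : Set (ℝ × ℝ) := Ioo s (2 * s) ×ˢ Ioo l (1 / (4 * s ^ 2)) with hB_def
  have hB : B ⊆ Ioo l L ×ˢ Ioo l L :=
    prod_mono (Ioo_subset_Ioo hls hL) (Ioo_subset_Ioo le_rfl hL')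
  have hBmeas : MeasurableSet B := measurableSet_Ioo.prod measurableSet_Ioo
  have hsq := integrableOn_toy_square (L := L) hl
  have h8pos : 0 < 1 / (8 * s ^ 2) := by positivity
  have hq : 1 / (4 * s ^ 2) = 2 * (1 / (8 * s ^ 2)) := by
    field_simp
    ring
  have hvol : (volume : Measure (ℝ × ℝ)).real B = s * (1 / (4 * s ^ 2) - l) := by
    rw [measureReal_def, hB_def, Measure.volume_eq_prod, Measure.prod_prod, Real.volume_Ioo, Real.volume_Ioo,
      ENNReal.toReal_mul, ENNReal.toReal_ofReal (by linarith), ENNReal.toReal_ofReal (by linarith)]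
    ring
  -- on B the integrand is at least 1/2
  have hhalf : ∀ p ∈ B, (1 / 2 : ℝ) ≤ 1 / (p.1 ^ 4 * p.2 ^ 2 + 1) := by
    rintro ⟨x, y⟩ ⟨⟨hx1, hx2⟩, ⟨hy1, hy2⟩⟩
    have hx0 : 0 < x := hs.trans hx1
    have hy0 : 0 < y := hl.trans hy1
    have hx4 : x ^ 4 ≤ 16 * s ^ 4 := by
      have : x ^ 4 ≤ (2 * s) ^ 4 := pow_le_pow_left₀ hx0.le hx2.le 4
      nlinarith
    have hy2' : y ^ 2 ≤ (1 / (4 * s ^ 2)) ^ 2 := pow_le_pow_left₀ hy0.le hy2.le 2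
    have hprod : x ^ 4 * y ^ 2 ≤ 1 := by
      calc x ^ 4 * y ^ 2 ≤ 16 * s ^ 4 * (1 / (4 * s ^ 2)) ^ 2 :=
            mul_le_mul hx4 hy2' (by positivity) (by positivity)
        _ = 1 := by field_simp; ring
    show (1 / 2 : ℝ) ≤ 1 / (x ^ 4 * y ^ 2 + 1)
    rw [div_le_div_iff₀ (by norm_num) (by positivity)]
    linarith
  calc 1 / (16 * s) ≤ (1 / 2 : ℝ) * (s * (1 / (4 * s ^ 2) - l)) := by
        have h8 : s * (1 / (4 * s ^ 2) - l) ≥ s * (1 / (8 * s ^ 2)) :=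
          mul_le_mul_of_nonneg_left (by linarith) hs.le
        have h16 : s * (1 / (8 * s ^ 2)) = 1 / (8 * s) := by field_simp
        rw [h16] at h8
        have : (1 / 2 : ℝ) * (1 / (8 * s)) = 1 / (16 * s) := by ring
        linarith
    _ = ∫ _ in B, (1 / 2 : ℝ) := by
        rw [setIntegral_const, hvol, smul_eq_mul, mul_comm]
    _ ≤ ∫ p in B, 1 / (p.1 ^ 4 * p.2 ^ 2 + 1) := by
        refine setIntegral_mono_on ?_ (hsq.mono_set hB) hBmeas hhalf
        refine integrableOn_const ?_
        rw [hB_def, Measure.volume_eq_prod, Measure.prod_prod, Real.volume_Ioo, Real.volume_Ioo]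
        exact ENNReal.mul_ne_top ENNReal.ofReal_ne_top ENNReal.ofReal_ne_top
    _ ≤ ∫ p in Ioo l L ×ˢ Ioo l L, 1 / (p.1 ^ 4 * p.2 ^ 2 + 1) :=
        setIntegral_mono_set hsq (Filter.Eventually.of_forall fun p => toy_nonneg p) hB.eventuallyLE

/-- **"However, the simultaneous limit lim_{λ→0,Λ→+∞} f(λ,Λ) is infinite"**: for every `T` there are `λ₀ > 0` and `Λ₀` such that
`T ≤ f(λ,Λ)` whenever `0 < λ ≤ λ₀` and `Λ₀ ≤ Λ`. [cite: Volkov2020, §1 (journal p.4; arXiv:1912.04885v4 tex l.107)] -/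
theorem toySquare_unbounded (T : ℝ) :
    ∃ l₀ L₀ : ℝ, 0 < l₀ ∧ ∀ l L : ℝ, 0 < l → l ≤ l₀ → L₀ ≤ L →
      T ≤ ∫ p in Ioo l L ×ˢ Ioo l L, 1 / (p.1 ^ 4 * p.2 ^ 2 + 1) := by
  set s : ℝ := 1 / (16 * (|T| + 1)) with hs_def
  have hT1 : 0 < |T| + 1 := by positivity
  have hs : 0 < s := by positivity
  refine ⟨min s (1 / (8 * s ^ 2)), max (2 * s) (1 / (4 * s ^ 2)), lt_min hs (by positivity), ?_⟩
  intro l L hl hl0 hL0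
  have key := toySquare_ge (L := L) hs hl (hl0.trans (min_le_left _ _)) (hl0.trans (min_le_right _ _))
    ((le_max_left _ _).trans hL0) ((le_max_right _ _).trans hL0)
  have h16 : 1 / (16 * s) = |T| + 1 := by
    rw [hs_def]; field_simp
  rw [h16] at key
  linarith [le_abs_self T]

/-- The quadrant version of "the simultaneous limit is infinite": `1/(x⁴y²+1)` is NOT integrable on `{x > 0, y > 0}` — the sub-strips
`{x > λ, y > 0}` alone carry `(π/2)/λ`, unbounded as `λ → 0`. (So for the positive-variable toy the whole integral is the mixed IR×UV
divergence, while `toySquare_le_strip_x` / `toySquare_le_strip_y` show it is invisible from either single limit.)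
[cite: Volkov2020, §1 (journal p.4; arXiv:1912.04885v4 tex l.105–107)] -/
theorem not_integrableOn_toy_quadrant :
    ¬ IntegrableOn (fun p : ℝ × ℝ => 1 / (p.1 ^ 4 * p.2 ^ 2 + 1)) (Ioi 0 ×ˢ Ioi 0) := by
  intro h
  set T := ∫ p in Ioi (0:ℝ) ×ˢ Ioi (0:ℝ), 1 / (p.1 ^ 4 * p.2 ^ 2 + 1) with hT_def
  have hT : 0 ≤ T := setIntegral_nonneg (measurableSet_Ioi.prod measurableSet_Ioi) fun p _ => toy_nonneg p
  have hl : 0 < (π / 2) / (T + 1) := by positivity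
  have hsub : Ioi ((π / 2) / (T + 1)) ×ˢ Ioi (0:ℝ) ⊆ Ioi 0 ×ˢ Ioi 0 := prod_mono (Ioi_subset_Ioi hl.le) le_rfl
  have h1 : ∫ p in Ioi ((π / 2) / (T + 1)) ×ˢ Ioi (0:ℝ), 1 / (p.1 ^ 4 * p.2 ^ 2 + 1) ≤ T :=
    setIntegral_mono_set h (Filter.Eventually.of_forall fun p => toy_nonneg p) hsub.eventuallyLE
  rw [setIntegral_toy_strip_x hl] at h1
  have h2 : (π / 2) / ((π / 2) / (T + 1)) = T + 1 := by
    field_simp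
  linarith

end

end Literature.MathematicalPhysics.QuantumFieldTheory.Volkov2020
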